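import Summits.ResolutionOfSingularities.ResolutionOfSingularities.Theorems.EquisingularLiftEquisingularLiftOrdinaryPointsJacobianLinSubst
import Literature.Algebra.Polynomial.JacobianCriterion
import HarnessLib

/-!
# [OURS] THE SINGULAR LOCUS IN THE ORIGINAL COORDINATES: the classical Jacobian condition travels along a linear change of coordinates
# (cruxes `EquisingularLift` stmt-…-15660 / `EquisingularLiftNat(Three)` stmt-…-20038 / -20148; every dimension, every characteristic)

[OURS · leafhand-res-equisingularlift-7 g1, 2026-08-31; cell `pub/decomp-res`] AI-produced, weaker than expert review; NOT a statement of any manuscript;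
nothing here proves resolution of singularities.  DEF-FREE helper; no `sorry`; standard axioms; ZERO named hypotheses.

✓ `MultiOrd.elNatAt_of_linSubst_ordinaryPoints_of_jacobian` / ✓ `StrataSplit.blowupModel_of_range_eq_of_linSubst_ordinaryPoints_of_jacobian` (p824133) ask
for the Jacobian condition (jac) on the TRANSFORMED form `σ_{τ'} F`.  Here (jac) is moved back to `F` ITSELF — the chain rule
(✓ `Literature.Algebra.Polynomial.JacobianCriterion.pderiv_aeval`, Humphreys §3.10) along the mutually inverse linear substitutions `τ, τ'`:

* `MultiOrd.eval_aeval_eq_eval` — `(σ_g F)(a) = F(g(a))`; `MultiOrd.eval_linSubst_point` — the new coordinates of the point `τ'(a)` are `a`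
  (`τ_i(τ'(a)) = a_i`); `MultiOrd.eval_zero_of_isHomogeneous_one` — linear forms vanish at `0`;
* ★ `MultiOrd.jacobian_of_linSubst` — **if every singular closed point `b ≠ 0` of `F` (`F(b) = 0`, `∇F(b) = 0`) lies on one of the marked points
  `{τ_i = 0, i ≠ c}` (`c ∈ S`) of the NEW coordinate system, then `σ_{τ'} F` satisfies (jac) at the marked coordinate vertices** (the singular points of
  `σ_{τ'} F` are the `τ`-coordinates of those of `F`);
* ★★ `MultiOrd.elNatAt_of_linSubst_ordinaryPoints_of_jacobian'`, ★★ `StrataSplit.blowupModel_of_range_eq_of_linSubst_ordinaryPoints_of_jacobian'` —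
  BOTH currencies for every `(H, ι)`, `range ι = V₊(F)`, from: new linear coordinates `x'_i = τ_i(x)` (inverse `τ'`), a duplicate-free marking `S`,
  (ord) the vertex charts of `σ_{τ'} F` at `c ∈ S` are `Φ_c + Ψ_c` with `Φ_c` a nonsingular form, and (jac) IN THE ORIGINAL COORDINATES: every singular
  point of `V₊(F)` is one of the points `P_c = {τ_i = 0 (i ≠ c)}`, `c ∈ S`.

Honest label: closes no registered stub; plumbing that makes the ordinary-points family usable with the singular locus computed once, in the given
coordinates.

References: [Humphreys1990, §3.10]; [Hartshorne1977, I Thm. 5.1, II Example 7.1.1].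
-/

set_option linter.dupNamespace false -- mandated namespace `Summit.<Summit>.<Problem>` of this single-conjunct summit

noncomputable section

open CategoryTheory CategoryTheory.Limits AlgebraicGeometry TopologicalSpace
open MvPolynomial
open Literature.AlgebraicGeometry.Resolution
open Literature.AlgebraicGeometry.Motives Literature.AlgebraicGeometry.Motives.SmoothHypersurface
open Literature.AlgebraicGeometry.Motives.ProjectiveSpace

namespace Summit.ResolutionOfSingularities.ResolutionOfSingularities.Cruxes.EquisingularLiftNat.Sections

namespace MultiOrd

variable {K : Type} [Field K] {N : ℕ}

/-- `(σ_g F)(a) = F(g₀(a), …, g_N(a))`. [folklore] -/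
theorem eval_aeval_eq_eval (g : Fin (N + 1) → MvPolynomial (Fin (N + 1)) K) (a : Fin (N + 1) → K) (F : MvPolynomial (Fin (N + 1)) K) :
    eval a (aeval g F) = eval (fun j => eval a (g j)) F := by
  rw [MvPolynomial.aeval_eq_bind₁]
  exact eval₂Hom_bind₁ _ _ _ _

/-- **The new coordinates of `τ'(a)` are `a`**: `τ_i(τ'_0(a), …, τ'_N(a)) = a_i` when `σ_{τ'} τ_i = x_i`. [folklore] -/
theorem eval_linSubst_point (τ τ' : Fin (N + 1) → MvPolynomial (Fin (N + 1)) K) (hinv' : ∀ i, aeval τ' (τ i) = X i)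
    (a : Fin (N + 1) → K) (i : Fin (N + 1)) : eval (fun j => eval a (τ' j)) (τ i) = a i := by
  rw [← eval_aeval_eq_eval, hinv', eval_X]

/-- Linear forms vanish at the origin. [folklore] -/
theorem eval_zero_of_isHomogeneous_one {φ : MvPolynomial (Fin (N + 1)) K} (h : φ.IsHomogeneous 1) :
    eval (0 : Fin (N + 1) → K) φ = 0 := by
  have h0 : eval (0 : Fin (N + 1) → K) φ = constantCoeff φ := by
    rw [show (0 : Fin (N + 1) → K) = fun _ => 0 from rfl, eval_zero']
  rw [h0, show constantCoeff φ = coeff 0 φ from congrFun constantCoeff_eq φ]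
  exact h.coeff_eq_zero (by simp)

/-- ★ **(jac) travels along a linear change of coordinates.**  `τ, τ'` mutually inverse linear substitutions (`τ_i` linear forms — the new coordinates),
`S` a marking.  If every `b ≠ 0` with `F(b) = 0` and `∇F(b) = 0` satisfies `τ_i(b) = 0` for all `i ≠ c`, for some `c ∈ S` (i.e. `[b]` is the marked point
`P_c` of the new coordinate system), then every `a ≠ 0` with `σ_{τ'}F(a) = 0`, `∇σ_{τ'}F(a) = 0` is a multiple of a marked vertex `e_c`: with `b = τ'(a)`
one has `F(b) = σ_{τ'}F(a) = 0`, `a = τ(b)` (so `b ≠ 0`), and `∂_jF(b) = Σ_i ∂_iσ_{τ'}F(a)·∂_jτ_i = 0` by the chain rule applied to `F = σ_τ σ_{τ'} F`.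
[cite: Humphreys1990, §3.10] -/
theorem jacobian_of_linSubst (τ τ' : Fin (N + 1) → MvPolynomial (Fin (N + 1)) K) (hτ : ∀ i, (τ i).IsHomogeneous 1)
    (hinv : ∀ i, aeval τ (τ' i) = X i) (hinv' : ∀ i, aeval τ' (τ i) = X i)
    (S : List (Fin (N + 1))) (F : MvPolynomial (Fin (N + 1)) K)
    (hjacF : ∀ b : Fin (N + 1) → K, b ≠ 0 → eval b F = 0 → (∀ j, eval b (pderiv j F) = 0) →
      ∃ c ∈ S, ∀ i, i ≠ c → eval b (τ i) = 0) :
    ∀ a : Fin (N + 1) → K, a ≠ 0 → eval a (aeval τ' F) = 0 → (∀ i, eval a (pderiv i (aeval τ' F)) = 0) →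
      ∃ c ∈ S, ∀ i, i ≠ c → a i = 0 := by
  classical
  intro a ha hG0 hGd
  have hba : ∀ i, eval (fun j => eval a (τ' j)) (τ i) = a i := fun i => eval_linSubst_point τ τ' hinv' a i
  have hfun : (fun i => eval (fun j => eval a (τ' j)) (τ i)) = a := funext hba
  have hb0 : (fun j => eval a (τ' j)) ≠ 0 := by
    intro h
    apply ha
    funext i
    rw [← hba i, h, eval_zero_of_isHomogeneous_one (hτ i), Pi.zero_apply]
  have hF0 : eval (fun j => eval a (τ' j)) F = 0 := by rw [← eval_aeval_eq_eval]; exact hG0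
  have hFG : aeval τ (aeval τ' F) = F := by
    have h1 : (aeval τ).comp (aeval τ') = AlgHom.id K (MvPolynomial (Fin (N + 1)) K) :=
      MvPolynomial.algHom_ext fun i => by rw [AlgHom.comp_apply, aeval_X, hinv, AlgHom.id_apply]
    have h2 := congrArg (fun φ : MvPolynomial (Fin (N + 1)) K →ₐ[K] MvPolynomial (Fin (N + 1)) K => φ F) h1
    simpa using h2
  have hFd : ∀ j, eval (fun j => eval a (τ' j)) (pderiv j F) = 0 := by
    intro j
    rw [← hFG, Literature.Algebra.Polynomial.JacobianCriterion.pderiv_aeval, map_sum]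
    refine Finset.sum_eq_zero fun i _ => ?_
    rw [map_mul, eval_aeval_eq_eval, hfun, hGd i, zero_mul]
  obtain ⟨c, hc, hcz⟩ := hjacF _ hb0 hF0 hFd
  exact ⟨c, hc, fun i hi => by rw [← hba i]; exact hcz i hi⟩

/-- ★★ **EL♮ (`ELNatAt`) for every `(H, ι)` whose singular points are ordinary multiple points in linearly general position — the singular locus read
in the ORIGINAL coordinates.**  `K = K̄` of characteristic `p`; `range ι = V₊(F)`, `F` a prime form; new linear coordinates `x'_i = τ_i(x)` with inverse
substitution `τ'`; a duplicate-free marking `S`; (ord) the vertex charts of `σ_{τ'} F` at `c ∈ S` read `Φ_c + Ψ_c`, `Φ_c` a NONSINGULAR form of degree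
`μ_c ≥ 1`, `Ψ_c ∈ (y)^{μ_c+1}`; (jac) every `b ≠ 0` with `F(b) = 0`, `∇F(b) = 0` is one of the marked points `{τ_i = 0 (i ≠ c)}`, `c ∈ S`.
✓ `elNatAt_of_linSubst_ordinaryPoints_of_jacobian` + `jacobian_of_linSubst`. [OURS · L1 W4.5b] [cite: Hartshorne1977, I Thm. 5.1, II Example 7.1.1] -/
theorem elNatAt_of_linSubst_ordinaryPoints_of_jacobian' (p : ℕ) (hp : p.Prime) [CharP K p] [IsAlgClosed K] {m : ℕ}
    {H : Scheme.{0}} (ι : H ⟶ (projectiveSpace (m + 1 + 1) K).left) [IsClosedImmersion ι]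
    (F : MvPolynomial (Fin (m + 1 + 1 + 1)) K) {d : ℕ} (hF : F.IsHomogeneous d) (hFp : Prime F)
    (hrange : letI := MvPolynomial.gradedAlgebra (σ := Fin (m + 1 + 1 + 1)) (R := K)
      Set.range ι = {x : Proj (homogeneousSubmodule (Fin (m + 1 + 1 + 1)) K) | F ∈ x.asHomogeneousIdeal})
    (τ τ' : Fin (m + 1 + 1 + 1) → MvPolynomial (Fin (m + 1 + 1 + 1)) K) (hτ : ∀ i, (τ i).IsHomogeneous 1) (hτ' : ∀ i, (τ' i).IsHomogeneous 1)
    (hinv : ∀ i, aeval τ (τ' i) = X i) (hinv' : ∀ i, aeval τ' (τ i) = X i)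
    (S : List (Fin (m + 2 + 1))) (hS : S.Nodup)
    (hord : ∀ c ∈ S, ∃ (μ : ℕ) (Φ Ψ : MvPolynomial (Fin (m + 2)) K), 1 ≤ μ ∧ Φ.IsHomogeneous μ ∧ IsNonsingularForm K Φ ∧
      Ψ ∈ Ideal.span (Set.range (X : Fin (m + 2) → MvPolynomial (Fin (m + 2)) K)) ^ (μ + 1) ∧
        ProjectiveSpace.dehomogenize K c (aeval τ' F) = Φ + Ψ)
    (hjacF : ∀ b : Fin (m + 2 + 1) → K, b ≠ 0 → eval b F = 0 → (∀ j, eval b (pderiv j F) = 0) →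
      ∃ c ∈ S, ∀ i, i ≠ c → eval b (τ i) = 0) :
    Theorems.EquisingularLift.ELNatAt p K (m + 1 + 1) H ι :=
  elNatAt_of_linSubst_ordinaryPoints_of_jacobian p hp ι F hF hFp hrange τ τ' hτ hτ' hinv hinv' S hS hord
    (jacobian_of_linSubst τ τ' hτ hinv hinv' S F hjacF)

end MultiOrd

end Summit.ResolutionOfSingularities.ResolutionOfSingularities.Cruxes.EquisingularLiftNat.Sections

namespace Summit.ResolutionOfSingularities.ResolutionOfSingularities.Cruxes.EquisingularLift.StrataSplit

open Summit.ResolutionOfSingularities.ResolutionOfSingularities.Cruxes.EquisingularLiftNat.Sections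

/-- ★★ **Regular blow-up models for every `(H, ι)` whose singular points are ordinary multiple points in linearly general position — the singular locus
read in the ORIGINAL coordinates** (`K = K̄`, any characteristic, any dimension): hypotheses as in
✓ `MultiOrd.elNatAt_of_linSubst_ordinaryPoints_of_jacobian'`; conclusion = that of the open residual `stub_blowupModel_ge_five` at `H`.
✓ `blowupModel_of_range_eq_of_linSubst_ordinaryPoints_of_jacobian` + ✓ `MultiOrd.jacobian_of_linSubst`. [cite: Hartshorne1977, II Example 7.1.1, II Ex. 7.12] -/
theorem blowupModel_of_range_eq_of_linSubst_ordinaryPoints_of_jacobian' {K : Type} [Field K] [IsAlgClosed K] {m : ℕ} {H : Scheme.{0}}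
    (ι : H ⟶ (projectiveSpace (m + 1 + 1) K).left) [IsClosedImmersion ι] [IsIntegral H]
    (F : MvPolynomial (Fin (m + 1 + 1 + 1)) K) {d : ℕ} (hF : F.IsHomogeneous d) (hFp : Prime F)
    (hrange : letI := MvPolynomial.gradedAlgebra (σ := Fin (m + 1 + 1 + 1)) (R := K)
      Set.range ι = {x : Proj (homogeneousSubmodule (Fin (m + 1 + 1 + 1)) K) | F ∈ x.asHomogeneousIdeal})
    (τ τ' : Fin (m + 1 + 1 + 1) → MvPolynomial (Fin (m + 1 + 1 + 1)) K) (hτ : ∀ i, (τ i).IsHomogeneous 1) (hτ' : ∀ i, (τ' i).IsHomogeneous 1)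
    (hinv : ∀ i, aeval τ (τ' i) = X i) (hinv' : ∀ i, aeval τ' (τ i) = X i)
    (S : List (Fin (m + 2 + 1))) (hS : S.Nodup)
    (hord : ∀ c ∈ S, ∃ (μ : ℕ) (Φ Ψ : MvPolynomial (Fin (m + 2)) K), 1 ≤ μ ∧ Φ.IsHomogeneous μ ∧ IsNonsingularForm K Φ ∧
      Ψ ∈ Ideal.span (Set.range (X : Fin (m + 2) → MvPolynomial (Fin (m + 2)) K)) ^ (μ + 1) ∧
        ProjectiveSpace.dehomogenize K c (aeval τ' F) = Φ + Ψ)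
    (hjacF : ∀ b : Fin (m + 2 + 1) → K, b ≠ 0 → eval b F = 0 → (∀ j, eval b (pderiv j F) = 0) →
      ∃ c ∈ S, ∀ i, i ≠ c → eval b (τ i) = 0) :
    ∃ 𝔞 : H.IdealSheafData, 𝔞 ≠ ⊥ ∧ ∀ (Z : Scheme.{0}) (π : Z ⟶ H), IsBlowup π 𝔞 → Scheme.IsRegular Z :=
  blowupModel_of_range_eq_of_linSubst_ordinaryPoints_of_jacobian ι F hF hFp hrange τ τ' hτ hτ' hinv hinv' S hS hord
    (MultiOrd.jacobian_of_linSubst τ τ' hτ hinv hinv' S F hjacF)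

end Summit.ResolutionOfSingularities.ResolutionOfSingularities.Cruxes.EquisingularLift.StrataSplit

end
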